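import Summits.RiemannHypothesis.RiemannHypothesis.Theorems.TiltedLandingLaw421R3BudgetCaseB1

/-!
# K-2 budget, the perturbative box on a geometric cell — PART 1: the cell criterion and the real cores (C1 g36, W-08 ⟨33346⟩)

With images J/K/L tree (#1203/#1206/#1207), `GeometricBudget 10 μ₀` (`μ₀ ≤ 1/2`) follows from its restriction to the PERTURBATIVE BOX `t_v < 3/2 ∧ t_z < 5`
(`geometricBudget_ten_of_box`).  The box is discharged on one GEOMETRIC CELL by the ONE-SHOT CRUDE-NORM architecture of part 2 (`…R3BudgetBox`,
`budget_box_cell`); this part holds the purely REAL half: the linear-quadratic CELL CRITERION `CellOK S₀ T₁ P₁ β₀ μ₀`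
(`13/50 + (181/50)μ₀ + 2T₁P₁ + (361/100)μ₀/β₀ + (3/200)T₁²/β₀² + 1/1000 ≤ (749/25)S₀ + (499/50)(1 + μ₀)`) and the seven real cores it is the sum of —
the v-block (`vdoors_real`, `vbox_real`: lost quadratic term `≤ 13/50 + (13/25)μ₀`, Newton disc, small doors), the z-block (`zdeficit_real`, `zdoor1_real`,
`zdoor23_real`, `zbox_real`: deficit weight `κ²/‖K_z‖² ≤ 2P₁`, main door `(361/100)μ₀/β₀`, small doors `(3/200)T₁²/β₀²`) and the bookkeeping sum
`sum_real`.  Every statement here is an inequality between real numbers; no complex analysis, no pair geometry.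
STATUS: support.  Nothing here bears on the truth of RH; RH is not proved; 33346 / 33347 OPEN. -/

namespace RhW08.BudgetBox

/-! ## §1 The cell criterion -/

/-- §1 THE CELL CRITERION on five cell constants: `S₀ ≤ S` (zeroth-order slack), `T_z ≤ T₁`, `Im v·‖K_z − K_v‖ ≤ P₁`, `β₀·Im v ≤ Im z`, `μ₀`:
`13/50 + (181/50)μ₀ + 2T₁P₁ + (361/100)μ₀/β₀ + (3/200)T₁²/β₀² + 1/1000 ≤ (749/25)S₀ + (499/50)(1 + μ₀)`. -/
def CellOK (S₀ T₁ P₁ β₀ μ₀ : ℝ) : Prop :=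
  13 / 50 + (181 / 50) * μ₀ + 2 * T₁ * P₁ + (361 / 100) * μ₀ / β₀ + (3 / 200) * T₁ ^ 2 / β₀ ^ 2 + 1 / 1000 ≤
    (749 / 25) * S₀ + (499 / 50) * (1 + μ₀)

/-! ## §2 Real cores: the v-block -/

/-- §2 (v-doors, real) `L ≥ 29.96`, `k² ≤ L² + 7/4`, `0 ≤ μ₀ ≤ 1/2` ⇒ the two v-door terms are `≤ ((181/50)μ₀ + 1/1000)/L`. -/
theorem vdoors_real {k L μ₀ : ℝ} (hL : 2996 / 100 ≤ L) (hkL : k ^ 2 ≤ L ^ 2 + 7 / 4) (hμ0 : 0 ≤ μ₀) (hμ : μ₀ ≤ 1 / 2) :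
    (18 / 5) * μ₀ * (1 + 3 / (2 * L ^ 2)) * k ^ 2 / L ^ 3 + (81 / 25) * μ₀ ^ 2 * k ^ 2 / L ^ 6 ≤ ((181 / 50) * μ₀ + 1 / 1000) / L := by
  have hL0 : 0 < L := by linarith
  have hL2 : 897 ≤ L ^ 2 := by nlinarith
  have hk2 : k ^ 2 ≤ (1002 / 1000) * L ^ 2 := by nlinarith
  have hk0 : 0 ≤ k ^ 2 := sq_nonneg k
  -- first door
  have h1 : (18 / 5) * μ₀ * (1 + 3 / (2 * L ^ 2)) * k ^ 2 / L ^ 3 ≤ (181 / 50) * μ₀ / L := by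
    have hf : 1 + 3 / (2 * L ^ 2) ≤ 10017 / 10000 := by
      rw [← sub_nonneg]
      have e : (10017 : ℝ) / 10000 - (1 + 3 / (2 * L ^ 2)) = (17 * (2 * L ^ 2) - 30000) / (10000 * (2 * L ^ 2)) := by
        field_simp; ring
      rw [e]; apply div_nonneg (by nlinarith) (by positivity)
    have hf0 : 0 ≤ 1 + 3 / (2 * L ^ 2) := by positivity
    calc (18 / 5) * μ₀ * (1 + 3 / (2 * L ^ 2)) * k ^ 2 / L ^ 3
        ≤ (18 / 5) * μ₀ * (10017 / 10000) * ((1002 / 1000) * L ^ 2) / L ^ 3 := by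
          apply div_le_div_of_nonneg_right _ (by positivity)
          have := mul_le_mul hf hk2 hk0 (by norm_num)
          nlinarith [mul_le_mul_of_nonneg_left this (by positivity : (0:ℝ) ≤ (18 / 5) * μ₀)]
      _ = ((18 / 5) * (10017 / 10000) * (1002 / 1000)) * μ₀ / L := by field_simp
      _ ≤ (181 / 50) * μ₀ / L := by
          apply div_le_div_of_nonneg_right _ hL0.le
          nlinarith
  -- second door
  have h2 : (81 / 25) * μ₀ ^ 2 * k ^ 2 / L ^ 6 ≤ (1 / 1000) / L := by
    rw [div_le_div_iff₀ (by positivity) hL0]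
    have hμ2 : μ₀ ^ 2 ≤ 1 / 4 := by nlinarith
    have h3 : μ₀ ^ 2 * k ^ 2 ≤ (1 / 4) * ((1002 / 1000) * L ^ 2) := mul_le_mul hμ2 hk2 hk0 (by norm_num)
    have hL4 : 897 * L ^ 2 ≤ L ^ 4 := by nlinarith
    have hL6 : L ^ 6 = L ^ 4 * L ^ 2 := by ring
    nlinarith [mul_le_mul_of_nonneg_right hL4 (by positivity : (0:ℝ) ≤ L ^ 2)]
  rw [add_div]
  linarith

set_option maxHeartbeats 400000 in
/-- §2 (v-block, real) `k ≥ 30`, `L² = k² + t − 1/4`, `Tv/2 ≤ t ≤ 3/2`, `−3 ≤ Tv`, `0 ≤ μ₀ ≤ 1/2` ⇒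
`Tv − (13/50 + (181/50)μ₀)/L ≤ 2tk²/L² − k²t²/L⁴ − (18/5)μ₀(1 + 3/(2L²))k²/L³ − (81/25)μ₀²k²/L⁶`. -/
theorem vbox_real {k L t Tv μ₀ : ℝ} (hk : 30 ≤ k) (hL0 : 0 < L) (hkL : L ^ 2 = k ^ 2 + t - 1 / 4) (hTv : Tv / 2 ≤ t) (ht2 : t ≤ 3 / 2)
    (hTv3 : -3 ≤ Tv) (hμ0 : 0 ≤ μ₀) (hμ : μ₀ ≤ 1 / 2) :
    Tv - (13 / 50 + (181 / 50) * μ₀) / L ≤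
      2 * t * k ^ 2 / L ^ 2 - k ^ 2 * t ^ 2 / L ^ 4 - (18 / 5) * μ₀ * (1 + 3 / (2 * L ^ 2)) * k ^ 2 / L ^ 3 - (81 / 25) * μ₀ ^ 2 * k ^ 2 / L ^ 6 := by
  have ht1 : -(3 / 2) ≤ t := by linarith
  have hk2 : k ^ 2 = L ^ 2 - t + 1 / 4 := by linarith
  have hL2 : 898 ≤ L ^ 2 := by nlinarith
  have hL29 : 2996 / 100 ≤ L := by nlinarith
  have hL2p : 0 < L ^ 2 := by positivity
  have hL4 : 0 < L ^ 4 := by positivity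
  have hTv2 : Tv ≤ 3 := by linarith
  -- monotonicity in t: g(t) = 2t − t²/L² ≥ g(Tv/2)  (times L²)
  have hg : Tv * L ^ 2 - Tv ^ 2 / 4 ≤ 2 * t * L ^ 2 - t ^ 2 := by
    have h1 : 0 ≤ (t - Tv / 2) * (2 * L ^ 2 - t - Tv / 2) := mul_nonneg (by linarith) (by nlinarith)
    nlinarith
  -- main terms: Tv·L⁴ − 7.51·L² ≤ k²(2tL² − t²)
  have hprod : Tv * (t - 1 / 4) ≤ 21 / 4 := by
    nlinarith [mul_nonneg (by linarith : (0:ℝ) ≤ 3 - Tv) (by linarith : (0:ℝ) ≤ 7 / 4 + (t - 1 / 4)),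
      mul_nonneg (by linarith : (0:ℝ) ≤ 3 + Tv) (by linarith : (0:ℝ) ≤ 7 / 4 - (t - 1 / 4))]
  have hTvsq : Tv ^ 2 ≤ 9 := by nlinarith
  have hk2p : 0 ≤ L ^ 2 - t + 1 / 4 := by nlinarith
  have hpoly : Tv * L ^ 4 - (751 / 100) * L ^ 2 ≤ 2 * t * k ^ 2 * L ^ 2 - k ^ 2 * t ^ 2 := by
    have h1 : (L ^ 2 - t + 1 / 4) * (Tv * L ^ 2 - Tv ^ 2 / 4) ≤ (L ^ 2 - t + 1 / 4) * (2 * t * L ^ 2 - t ^ 2) :=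
      mul_le_mul_of_nonneg_left hg hk2p
    have h3 : (L ^ 2 - t + 1 / 4) * (Tv * L ^ 2 - Tv ^ 2 / 4) =
        Tv * L ^ 4 - Tv * (t - 1 / 4) * L ^ 2 - (L ^ 2 - t + 1 / 4) * Tv ^ 2 / 4 := by ring
    have h4 : (L ^ 2 - t + 1 / 4) * Tv ^ 2 ≤ (L ^ 2 + 7 / 4) * 9 := mul_le_mul (by linarith) hTvsq (sq_nonneg _) (by positivity)
    have h5 : Tv * (t - 1 / 4) * L ^ 2 ≤ (21 / 4) * L ^ 2 := mul_le_mul_of_nonneg_right hprod hL2p.le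
    have h6 : 2 * t * k ^ 2 * L ^ 2 - k ^ 2 * t ^ 2 = (L ^ 2 - t + 1 / 4) * (2 * t * L ^ 2 - t ^ 2) := by rw [hk2]; ring
    rw [h6]
    linarith
  have hmain : Tv - (751 / 100) / L ^ 2 ≤ 2 * t * k ^ 2 / L ^ 2 - k ^ 2 * t ^ 2 / L ^ 4 := by
    have e1 : Tv - (751 / 100) / L ^ 2 = (Tv * L ^ 4 - (751 / 100) * L ^ 2) / L ^ 4 := by field_simp
    have e2 : 2 * t * k ^ 2 / L ^ 2 - k ^ 2 * t ^ 2 / L ^ 4 = (2 * t * k ^ 2 * L ^ 2 - k ^ 2 * t ^ 2) / L ^ 4 := by field_simp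
    rw [e1, e2]
    exact div_le_div_of_nonneg_right hpoly hL4.le
  have hdoors := vdoors_real (k := k) hL29 (by linarith) hμ0 hμ
  -- bookkeeping: 7.51/L² ≤ 0.259/L
  have hb1 : (751 / 100) / L ^ 2 ≤ (259 / 1000) / L := by
    rw [div_le_div_iff₀ hL2p hL0]; nlinarith
  have hb2 : (259 / 1000) / L + ((181 / 50) * μ₀ + 1 / 1000) / L = (13 / 50 + (181 / 50) * μ₀) / L := by
    rw [← add_div]; ring
  linarith

/-! ## §3 Real cores: the z-block -/

/-- §3 (weight deficit, real) `Tz(1 − k²/(L+P₁)²) ≤ 2T₁P₁/L` (`0 ≤ Tz ≤ T₁`, `L² ≤ k² + 5/4`, `2/3 ≤ P₁`). -/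
theorem zdeficit_real {k L Tz T₁ P₁ : ℝ} (hL : 2996 / 100 ≤ L) (hLk : L ^ 2 ≤ k ^ 2 + 5 / 4) (hP1 : 2 / 3 ≤ P₁)
    (hTz0 : 0 ≤ Tz) (hTz2 : Tz ≤ T₁) :
    Tz - k ^ 2 / (L + P₁) ^ 2 * Tz ≤ 2 * T₁ * P₁ / L := by
  have hL0 : 0 < L := by linarith
  have hLP : 0 < L + P₁ := by linarith
  have hT0 : 0 ≤ T₁ := hTz0.trans hTz2
  have e1 : Tz - k ^ 2 / (L + P₁) ^ 2 * Tz = Tz * ((L + P₁) ^ 2 - k ^ 2) / (L + P₁) ^ 2 := by field_simp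
  rw [e1]
  have h2 : (L + P₁) ^ 2 - k ^ 2 ≤ 2 * L * P₁ + P₁ ^ 2 + 5 / 4 := by nlinarith
  have h3 : 0 ≤ 2 * L * P₁ + P₁ ^ 2 + 5 / 4 := by positivity
  have h1 : Tz * ((L + P₁) ^ 2 - k ^ 2) ≤ T₁ * (2 * L * P₁ + P₁ ^ 2 + 5 / 4) :=
    calc Tz * ((L + P₁) ^ 2 - k ^ 2) ≤ Tz * (2 * L * P₁ + P₁ ^ 2 + 5 / 4) := mul_le_mul_of_nonneg_left h2 hTz0
      _ ≤ T₁ * (2 * L * P₁ + P₁ ^ 2 + 5 / 4) := mul_le_mul_of_nonneg_right hTz2 h3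
  have h4 : T₁ * (2 * L * P₁ + P₁ ^ 2 + 5 / 4) / (L + P₁) ^ 2 ≤ 2 * T₁ * P₁ / L := by
    rw [div_le_div_iff₀ (by positivity) hL0]
    have hP0 : 0 ≤ P₁ := by linarith
    have hP12 : 4 / 9 ≤ P₁ ^ 2 := by nlinarith
    -- L(2LP₁ + P₁² + 5/4) ≤ 2P₁(L+P₁)²  ⇐  5L/4 ≤ 3P₁²L + 2P₁³
    have h5 : L * (2 * L * P₁ + P₁ ^ 2 + 5 / 4) ≤ 2 * P₁ * (L + P₁) ^ 2 := by
      nlinarith [mul_nonneg hP0 (sq_nonneg P₁), mul_le_mul_of_nonneg_left hP12 hL0.le]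
    have h6 := mul_le_mul_of_nonneg_left h5 hT0
    nlinarith
  exact (div_le_div_of_nonneg_right h1 (by positivity)).trans h4

/-- §3 (main z-door, real) `(k²/(L+P₁)²)·((18/5)μ₀/(β₀(L−P₁))) ≤ (361/100)μ₀/β₀/L` (`L³ ≤ (L+P₁)²(L−P₁)`, `k² ≤ L² + 7/4`). -/
theorem zdoor1_real {k L P₁ β₀ μ₀ : ℝ} (hL : 2996 / 100 ≤ L) (hkL : k ^ 2 ≤ L ^ 2 + 7 / 4) (hP0 : 0 ≤ P₁) (hP2 : P₁ ≤ 13 / 2)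
    (hβ : 1 ≤ β₀) (hμ0 : 0 ≤ μ₀) :
    k ^ 2 / (L + P₁) ^ 2 * ((18 / 5) * μ₀ / (β₀ * (L - P₁))) ≤ (361 / 100) * μ₀ / β₀ / L := by
  have hL0 : 0 < L := by linarith
  have hLP : 0 < L - P₁ := by linarith
  have hβ0 : 0 < β₀ := by linarith
  have hcube : L ^ 3 ≤ (L + P₁) ^ 2 * (L - P₁) := by
    nlinarith [mul_nonneg hP0 (by nlinarith : (0:ℝ) ≤ L ^ 2 - L * P₁ - P₁ ^ 2)]
  have hk36 : (18 / 5) * k ^ 2 ≤ (361 / 100) * L ^ 2 := by nlinarith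
  rw [div_mul_div_comm, div_div, div_le_div_iff₀ (by positivity) (by positivity)]
  -- k²·((18/5)μ₀)·(β₀·L) ≤ (361/100)μ₀·((L+P₁)²·(β₀(L−P₁)))
  have h1 : k ^ 2 * ((18 / 5) * μ₀) * (β₀ * L) = ((18 / 5) * k ^ 2) * L * (μ₀ * β₀) := by ring
  have h2 : (361 / 100) * μ₀ * ((L + P₁) ^ 2 * (β₀ * (L - P₁))) = (361 / 100) * ((L + P₁) ^ 2 * (L - P₁)) * (μ₀ * β₀) := by ring
  rw [h1, h2]
  apply mul_le_mul_of_nonneg_right _ (by positivity)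
  calc ((18 / 5) * k ^ 2) * L ≤ ((361 / 100) * L ^ 2) * L := mul_le_mul_of_nonneg_right hk36 hL0.le
    _ = (361 / 100) * L ^ 3 := by ring
    _ ≤ (361 / 100) * ((L + P₁) ^ 2 * (L - P₁)) := by nlinarith

set_option maxHeartbeats 400000 in
/-- §3 (small z-doors, real) the `T₁²` door and the `μ₀²` door at weight `k²/(L+P₁)² ≤ 501/500`, with `β₀(L−P₁) ≥ (39/50)β₀L`. -/
theorem zdoor23_real {k L T₁ P₁ β₀ μ₀ : ℝ} (hL : 2996 / 100 ≤ L) (hkL : k ^ 2 ≤ L ^ 2 + 7 / 4) (hP0 : 0 ≤ P₁) (hP2 : P₁ ≤ 13 / 2)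
    (hβ : 1 ≤ β₀) (hμ0 : 0 ≤ μ₀) (hμ : μ₀ ≤ 1 / 2) :
    k ^ 2 / (L + P₁) ^ 2 * (T₁ ^ 2 / (4 * (β₀ * (L - P₁)) ^ 2)) + k ^ 2 / (L + P₁) ^ 2 * ((81 / 25) * μ₀ ^ 2 / (β₀ * (L - P₁)) ^ 4) ≤
      (3 / 200) * T₁ ^ 2 / β₀ ^ 2 / L + (1 / 1000) / L := by
  have hL0 : 0 < L := by linarith
  have hβ0 : 0 < β₀ := by linarith
  set Λ := β₀ * (L - P₁) with hΛdef
  have hΛL : (39 / 50) * (β₀ * L) ≤ Λ := by rw [hΛdef]; nlinarith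
  have hΛ0 : 0 < Λ := by nlinarith
  have hΛ23 : 23 ≤ Λ := by nlinarith
  have hω : k ^ 2 / (L + P₁) ^ 2 ≤ 501 / 500 := by
    rw [div_le_iff₀ (by positivity)]; nlinarith
  have hω0 : 0 ≤ k ^ 2 / (L + P₁) ^ 2 := by positivity
  -- T₁² door
  have h1 : T₁ ^ 2 / (4 * Λ ^ 2) ≤ (74 / 5000) * T₁ ^ 2 / β₀ ^ 2 / L := by
    rw [div_div, div_le_div_iff₀ (by positivity) (by positivity)]
    -- T₁²·(β₀²L) ≤ (74/5000)T₁²·(4Λ²)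
    have h2 : β₀ ^ 2 * L ≤ (74 / 5000) * (4 * Λ ^ 2) := by
      have h3 : ((39 / 50) * (β₀ * L)) ^ 2 ≤ Λ ^ 2 := pow_le_pow_left₀ (by positivity) hΛL 2
      nlinarith [mul_le_mul_of_nonneg_left hL (by positivity : (0:ℝ) ≤ β₀ ^ 2 * L)]
    have := mul_le_mul_of_nonneg_left h2 (sq_nonneg T₁)
    nlinarith
  have h1' : k ^ 2 / (L + P₁) ^ 2 * (T₁ ^ 2 / (4 * Λ ^ 2)) ≤ (3 / 200) * T₁ ^ 2 / β₀ ^ 2 / L :=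
    calc k ^ 2 / (L + P₁) ^ 2 * (T₁ ^ 2 / (4 * Λ ^ 2)) ≤ (501 / 500) * ((74 / 5000) * T₁ ^ 2 / β₀ ^ 2 / L) :=
          mul_le_mul hω h1 (by positivity) (by norm_num)
      _ ≤ (3 / 200) * T₁ ^ 2 / β₀ ^ 2 / L := by
          rw [mul_div_assoc', mul_div_assoc']
          apply div_le_div_of_nonneg_right _ hL0.le
          apply div_le_div_of_nonneg_right _ (by positivity)
          nlinarith [sq_nonneg T₁]
  -- μ₀² door
  have h4 : (81 / 25) * μ₀ ^ 2 / Λ ^ 4 ≤ (1 / 2000) / L := by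
    rw [div_le_div_iff₀ (by positivity) hL0]
    have hμ2 : μ₀ ^ 2 ≤ 1 / 4 := by nlinarith
    have hΛ4 : (23:ℝ) ^ 3 * Λ ≤ Λ ^ 4 := by
      have := pow_le_pow_left₀ (by norm_num) hΛ23 3
      nlinarith
    have hLΛ : L ≤ 2 * Λ := by nlinarith
    nlinarith [mul_le_mul hμ2 hLΛ hL0.le (by norm_num : (0:ℝ) ≤ 1 / 4)]
  have h4' : k ^ 2 / (L + P₁) ^ 2 * ((81 / 25) * μ₀ ^ 2 / Λ ^ 4) ≤ (1 / 1000) / L :=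
    calc k ^ 2 / (L + P₁) ^ 2 * ((81 / 25) * μ₀ ^ 2 / Λ ^ 4) ≤ (501 / 500) * ((1 / 2000) / L) :=
          mul_le_mul hω h4 (by positivity) (by norm_num)
      _ ≤ (1 / 1000) / L := by rw [← mul_div_assoc]; exact div_le_div_of_nonneg_right (by norm_num) hL0.le
  have e4 : (4 * (β₀ * (L - P₁)) ^ 2) = 4 * Λ ^ 2 := by rw [hΛdef]
  rw [e4]
  linarith

set_option maxHeartbeats 400000 in
/-- §3 (z-block, real) the z-disc in the box, in the currencies `k = Im v·κ`, `L = Im v·‖K_v‖`, `m = Im v·‖K_z‖`, `Lz = Im z·‖K_z‖`: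
`|m − L| ≤ P₁ ∈ [2/3, 13/2]`, `β₀m ≤ Lz` (`β₀ ≥ 1`), `Tz/2 ≤ tz ≤ 5`, `1 ≤ Tz ≤ T₁ ≤ 10`, `L² ≤ k² + 5/4`, `k² ≤ L² + 7/4`, `L ≥ 29.96` ⇒
`Tz − (2T₁P₁ + (361/100)μ₀/β₀ + (3/200)T₁²/β₀² + 1/1000)/L ≤ (k²/m²)(2tz − tz²/Lz²) − (18/5)μ₀(k²/m²)/Lz − (81/25)μ₀²(k²/m²)/Lz⁴`. -/
theorem zbox_real {k L m Lz tz Tz T₁ P₁ β₀ μ₀ : ℝ} (hL : 2996 / 100 ≤ L) (hLk : L ^ 2 ≤ k ^ 2 + 5 / 4) (hkL : k ^ 2 ≤ L ^ 2 + 7 / 4)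
    (hm1 : L - P₁ ≤ m) (hm2 : m ≤ L + P₁) (hP1 : 2 / 3 ≤ P₁) (hP2 : P₁ ≤ 13 / 2) (hLz : β₀ * m ≤ Lz) (hβ : 1 ≤ β₀)
    (htz1 : Tz / 2 ≤ tz) (htz2 : tz ≤ 5) (hTz1 : 1 ≤ Tz) (hTz2 : Tz ≤ T₁) (hT1 : T₁ ≤ 10) (hμ0 : 0 ≤ μ₀) (hμ : μ₀ ≤ 1 / 2) :
    Tz - (2 * T₁ * P₁ + (361 / 100) * μ₀ / β₀ + (3 / 200) * T₁ ^ 2 / β₀ ^ 2 + 1 / 1000) / L ≤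
      k ^ 2 / m ^ 2 * (2 * tz - tz ^ 2 / Lz ^ 2) - (18 / 5) * μ₀ * (k ^ 2 / m ^ 2) / Lz - (81 / 25) * μ₀ ^ 2 * (k ^ 2 / m ^ 2) / Lz ^ 4 := by
  have hL0 : 0 < L := by linarith
  have hP0 : 0 ≤ P₁ := by linarith
  have hmpos : 0 < m := by linarith
  set Λ := β₀ * (L - P₁) with hΛdef
  have hΛ : 23 ≤ Λ := by rw [hΛdef]; nlinarith
  have hΛpos : 0 < Λ := by linarith
  have hLzΛ : Λ ≤ Lz := by rw [hΛdef]; nlinarith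
  have hLz0 : 0 < Lz := by linarith
  have hT0 : 0 ≤ T₁ := by linarith
  have hk2pos : 0 < k ^ 2 := by nlinarith
  set ω := k ^ 2 / m ^ 2 with hωdef
  have hω0 : 0 ≤ ω := by positivity
  -- (s1) monotonicity in tz (times 4Lz²)
  have hg : Tz - Tz ^ 2 / (4 * Lz ^ 2) ≤ 2 * tz - tz ^ 2 / Lz ^ 2 := by
    have h1 : 0 ≤ (tz - Tz / 2) * (2 * Lz ^ 2 - tz - Tz / 2) := mul_nonneg (by linarith) (by nlinarith)
    have e1 : Tz - Tz ^ 2 / (4 * Lz ^ 2) = (4 * Tz * Lz ^ 2 - Tz ^ 2) / (4 * Lz ^ 2) := by field_simp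
    have e2 : 2 * tz - tz ^ 2 / Lz ^ 2 = (4 * (2 * tz * Lz ^ 2 - tz ^ 2)) / (4 * Lz ^ 2) := by field_simp
    rw [e1, e2]
    exact div_le_div_of_nonneg_right (by nlinarith) (by positivity)
  -- (s2) the bracket against its value at Λ ≤ Lz with Tz² ≤ T₁²
  have hB1 : Tz ^ 2 / (4 * Lz ^ 2) ≤ T₁ ^ 2 / (4 * Λ ^ 2) := by
    have h1 : Tz ^ 2 ≤ T₁ ^ 2 := pow_le_pow_left₀ (by linarith) hTz2 2
    have h2 : 4 * Λ ^ 2 ≤ 4 * Lz ^ 2 := by nlinarith [mul_le_mul hLzΛ hLzΛ hΛpos.le hLz0.le]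
    calc Tz ^ 2 / (4 * Lz ^ 2) ≤ T₁ ^ 2 / (4 * Lz ^ 2) := div_le_div_of_nonneg_right h1 (by positivity)
      _ ≤ T₁ ^ 2 / (4 * Λ ^ 2) := div_le_div_of_nonneg_left (sq_nonneg _) (by positivity) h2
  have hB2 : (18 / 5) * μ₀ / Lz ≤ (18 / 5) * μ₀ / Λ := div_le_div_of_nonneg_left (by positivity) hΛpos hLzΛ
  have hB3 : (81 / 25) * μ₀ ^ 2 / Lz ^ 4 ≤ (81 / 25) * μ₀ ^ 2 / Λ ^ 4 :=
    div_le_div_of_nonneg_left (by positivity) (by positivity) (pow_le_pow_left₀ hΛpos.le hLzΛ 4)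
  -- (s3) the reduced bracket is nonnegative
  have hB0 : 0 ≤ Tz - T₁ ^ 2 / (4 * Λ ^ 2) - (18 / 5) * μ₀ / Λ - (81 / 25) * μ₀ ^ 2 / Λ ^ 4 := by
    have h1 : T₁ ^ 2 / (4 * Λ ^ 2) ≤ 1 / 4 := by
      rw [div_le_div_iff₀ (by positivity) (by norm_num)]
      have : T₁ ^ 2 ≤ Λ ^ 2 := pow_le_pow_left₀ hT0 (by linarith) 2
      linarith
    have h2 : (18 / 5) * μ₀ / Λ ≤ 1 / 4 := by
      rw [div_le_div_iff₀ hΛpos (by norm_num)]; nlinarith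
    have h3 : (81 / 25) * μ₀ ^ 2 / Λ ^ 4 ≤ 1 / 4 := by
      rw [div_le_div_iff₀ (by positivity) (by norm_num)]
      have hΛ4 : (23:ℝ) ^ 4 ≤ Λ ^ 4 := pow_le_pow_left₀ (by norm_num) hΛ 4
      have hμ2 : μ₀ ^ 2 ≤ 1 / 4 := by nlinarith
      nlinarith
    linarith
  -- (s4) ω ≥ ω₀ := k²/(L+P₁)²
  have hω1 : k ^ 2 / (L + P₁) ^ 2 ≤ ω :=
    div_le_div_of_nonneg_left hk2pos.le (by positivity) (pow_le_pow_left₀ hmpos.le hm2 2)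
  -- (s5) the right side is ω·(bracket) ≥ ω·(reduced bracket) ≥ ω₀·(reduced bracket)
  have hRHS : k ^ 2 / m ^ 2 * (2 * tz - tz ^ 2 / Lz ^ 2) - (18 / 5) * μ₀ * (k ^ 2 / m ^ 2) / Lz - (81 / 25) * μ₀ ^ 2 * (k ^ 2 / m ^ 2) / Lz ^ 4 =
      ω * (2 * tz - tz ^ 2 / Lz ^ 2 - (18 / 5) * μ₀ / Lz - (81 / 25) * μ₀ ^ 2 / Lz ^ 4) := by
    rw [hωdef]; ring
  have hstep1 : ω * (Tz - T₁ ^ 2 / (4 * Λ ^ 2) - (18 / 5) * μ₀ / Λ - (81 / 25) * μ₀ ^ 2 / Λ ^ 4) ≤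
      ω * (2 * tz - tz ^ 2 / Lz ^ 2 - (18 / 5) * μ₀ / Lz - (81 / 25) * μ₀ ^ 2 / Lz ^ 4) :=
    mul_le_mul_of_nonneg_left (by linarith) hω0
  have hstep2 : k ^ 2 / (L + P₁) ^ 2 * (Tz - T₁ ^ 2 / (4 * Λ ^ 2) - (18 / 5) * μ₀ / Λ - (81 / 25) * μ₀ ^ 2 / Λ ^ 4) ≤
      ω * (Tz - T₁ ^ 2 / (4 * Λ ^ 2) - (18 / 5) * μ₀ / Λ - (81 / 25) * μ₀ ^ 2 / Λ ^ 4) :=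
    mul_le_mul_of_nonneg_right hω1 hB0
  -- (s6) the deficit and the doors at weight ω₀
  have hdef := zdeficit_real (k := k) hL hLk hP1 (by linarith) hTz2
  have hd1 := zdoor1_real (k := k) hL hkL hP0 hP2 hβ hμ0
  have hd23 := zdoor23_real (k := k) (T₁ := T₁) hL hkL hP0 hP2 hβ hμ0 hμ
  -- assemble
  have e3 : (2 * T₁ * P₁ + (361 / 100) * μ₀ / β₀ + (3 / 200) * T₁ ^ 2 / β₀ ^ 2 + 1 / 1000) / L =
      2 * T₁ * P₁ / L + (361 / 100) * μ₀ / β₀ / L + (3 / 200) * T₁ ^ 2 / β₀ ^ 2 / L + (1 / 1000) / L := by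
    field_simp
  have e4 : k ^ 2 / (L + P₁) ^ 2 * (Tz - T₁ ^ 2 / (4 * Λ ^ 2) - (18 / 5) * μ₀ / Λ - (81 / 25) * μ₀ ^ 2 / Λ ^ 4) =
      k ^ 2 / (L + P₁) ^ 2 * Tz - k ^ 2 / (L + P₁) ^ 2 * (T₁ ^ 2 / (4 * Λ ^ 2)) - k ^ 2 / (L + P₁) ^ 2 * ((18 / 5) * μ₀ / Λ)
        - k ^ 2 / (L + P₁) ^ 2 * ((81 / 25) * μ₀ ^ 2 / Λ ^ 4) := by ring
  rw [hRHS, e3]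
  linarith [hstep1, hstep2, hdef, hd1, hd23, e4]

/-- §3 (sum, real) the two blocks + the cell criterion give the budget conclusion in `k`-currency (`499k ≤ 500L`). -/
theorem sum_real {k L Tv Tz S₀ T₁ P₁ β₀ μ₀ V Z : ℝ} (hk : 30 ≤ k) (hL : 2996 / 100 ≤ L) (hkL : 499 * k ≤ 500 * L)
    (hV : Tv - (13 / 50 + (181 / 50) * μ₀) / L ≤ V)
    (hZ : Tz - (2 * T₁ * P₁ + (361 / 100) * μ₀ / β₀ + (3 / 200) * T₁ ^ 2 / β₀ ^ 2 + 1 / 1000) / L ≤ Z)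
    (hS : S₀ ≤ Tv + Tz - 3) (hS0 : 0 ≤ S₀) (hμ0 : 0 ≤ μ₀) (hOK : CellOK S₀ T₁ P₁ β₀ μ₀) :
    3 - 10 * (1 + μ₀) / k ≤ V + Z := by
  have hk0 : 0 < k := by linarith
  have hL0 : 0 < L := by linarith
  unfold CellOK at hOK
  have h1 : (499 / 50) * (1 + μ₀) / L ≤ 10 * (1 + μ₀) / k := by
    rw [div_le_div_iff₀ hL0 hk0]; nlinarith
  have h2 : (749 / 25) * S₀ / L ≤ S₀ := by
    rw [div_le_iff₀ hL0]; nlinarith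
  have h3 : (13 / 50 + (181 / 50) * μ₀) / L + (2 * T₁ * P₁ + (361 / 100) * μ₀ / β₀ + (3 / 200) * T₁ ^ 2 / β₀ ^ 2 + 1 / 1000) / L ≤
      (749 / 25) * S₀ / L + (499 / 50) * (1 + μ₀) / L := by
    rw [← add_div, ← add_div]
    exact div_le_div_of_nonneg_right (by linarith) hL0.le
  linarith

end RhW08.BudgetBox
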